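import Literature.NumberTheory.Transcendental.KaehlerHodgeSymmProofs
import Literature.NumberTheory.Transcendental.KaehlerHodgeHarmonicClosedProofs
import Literature.NumberTheory.Transcendental.KaehlerHodgeDolbeaultHarmonicSubspaceProofs
import Literature.NumberTheory.Transcendental.KaehlerHodgeConjFact
import Literature.NumberTheory.Transcendental.KaehlerHodgeEllipticRepresentativeProofs
import HarnessLib

/-!
# Hodge symmetry `h^{p,q} = h^{q,p}`: assembly down to the analytic inputs (proofs)

Theorems-only companion of `KaehlerHodgeSymmProofs.lean` for the named fact
`Literature.NumberTheory.Transcendental.hodgeNumber_symm_of_isKaehlerManifold` of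
`Literature/NumberTheory/Transcendental/KaehlerHodge.lean` (Hodge symmetry of the Hodge numbers
`h^{p,q} = dim_ℂ H^{p,q}_{∂̄}` of a compact Hausdorff complex manifold admitting a smooth Kähler
metric; C. Voisin, *Hodge Theory and Complex Algebraic Geometry I* (2002), Cor. 6.12 with
Lemma 6.18; D. Huybrechts, *Complex Geometry* (2005), Cor. 3.2.12). `KaehlerHodgeSymmProofs.lean`
reduces that fact to the two Hodge-theoretic named facts
`finrank_dolbeaultHarmonicForms_eq_hodgeNumber g o` (`dim ℋ^{p,q}_g = h^{p,q}`) and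
`dolbeaultHarmonicForms_conj g o` (`\overline{ℋ^{p,q}_g} = ℋ^{q,p}_g`). This file pushes the
reduction down to the genuine inputs of the printed proofs, all of which the tree already
isolates; no named fact is introduced, everything here is proved:

* `finrank_dolbeaultHarmonicForms_eq_hodgeNumber_of_existsUnique` — **`dim_ℂ ℋ^{p,q} = h^{p,q}`
  from the Hodge theorem for `∂̄`** (`existsUnique_isDolbeaultHarmonic_mk_eq g o`: every Dolbeault
  class has a unique `Δ_∂̄`-harmonic representative; Voisin (2002), Thm. 5.24): on a compact
  complex manifold with a smooth Hermitian metric the class map `ℋ^{p,q} → H^{p,q}_{∂̄}`,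
  `α ↦ [α]` (defined since `ℋ^{p,q} ≤ Z^{p,q}_{∂̄}`,
  `dolbeaultHarmonicForms_le_dolbeaultClosedForms_of_isManifold_complex`, Voisin Cor. 5.13) is a
  linear bijection — surjective by existence, injective by uniqueness (elements of the span
  `ℋ^{p,q}` *are* harmonic, `mem_dolbeaultHarmonicForms_iff_of_contMDiffMetric`) — hence
  `LinearEquiv.finrank_eq`. This discharges the hypothesis `hfin` of
  `hodgeNumber_symm_of_isKaehlerManifold_of_dolbeaultHarmonicForms_conj` from the single fact
  `existsUnique_isDolbeaultHarmonic_mk_eq`.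
* `hodgeNumber_symm_of_isKaehlerManifold_of_existsUnique_of_kaehlerIdentity` — **Hodge symmetry
  from the Hodge theorem for `∂̄` and the Kähler identity `Δ_∂̄ = Δ_∂`** (the corrected named fact
  `dolbeaultLaplacian_eq_delLaplacian_of_isManifold_complex g o`, Voisin (2002), Thm. 6.7, through
  `dolbeaultHarmonicForms_conj_of_isManifold_complex_of_dolbeaultLaplacian_eq_delLaplacian` of
  `KaehlerHodgeConjFact.lean`): exactly the two theorems the printed proofs quote.
* `hodgeNumber_symm_of_isKaehlerManifold_of_regularity_of_compactness_of_kaehlerIdentity` — the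
  same with the Hodge theorem for `∂̄` replaced by its own analytic inputs, Warner's Theorems 6.6
  (compactness, `hC`) and 6.5 (regularity of weak solutions, `hR`) for `Δ_∂̄` on the inner product
  spaces `A^{p,q}(M)` (`CL2SmoothForms.pq`, `CL2SmoothForms.pqLaplacian`), via
  `existsUnique_isDolbeaultHarmonic_mk_eq_of_regularity_of_compactness`
  (`KaehlerHodgeEllipticRepresentativeProofs.lean`; Voisin (2002), Thm. 5.22 ⇒ Thm. 5.24).

**Status (D-0026 review of `hodgeNumber_symm_of_isKaehlerManifold`, 2026-08-15).** The fact is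
correctly stated (its binders carry the holomorphic atlas through `[IsKaehlerManifold E M]`) and is
the printed theorem; what its discharge `hodgeNumber_symm_of_isKaehlerManifold_holds` still lacks
is precisely (i) the elliptic theory of `Δ_∂̄` on a compact Hermitian manifold — the hypotheses
`hC`, `hR` below (Voisin (2002), Thm. 5.22, "which we will use without proof"; Rem. 5.26: "There is
no easy proof" even of the finiteness of `H^q(X, E)`) — and (ii) the first-order Kähler identities
`[Λ, ∂̄] = -i∂*`, `[Λ, ∂] = i∂̄*` (Voisin (2002), Prop. 6.5) behind `Δ_∂̄ = Δ_∂`. Neither is a matter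
of inline lemmas; both are left to their own seats, and the last theorem of this file is the term
that closes the fact once they land.

## References

* C. Voisin, *Hodge Theory and Complex Algebraic Geometry I*, Cambridge Studies in Advanced
  Mathematics 76 (2002): §5.1.4 Cor. 5.13; §5.2.3 Thm. 5.22; §5.3.1 Thm. 5.24, Cor. 5.25,
  Rem. 5.26; §6.1.2 Prop. 6.5, Thm. 6.7, Cor. 6.10; §6.1.3 Cor. 6.12, Lemma 6.18.
* D. Huybrechts, *Complex Geometry. An Introduction*, Universitext (2005): Prop. 3.1.12,
  Lemma 3.2.5, Remarks 3.2.7 (i), Cor. 3.2.12.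
* F. W. Warner, *Foundations of Differentiable Manifolds and Lie Groups*, GTM 94 (1983): 6.5, 6.6,
  6.8.
-/

noncomputable section

open scoped Manifold ContDiff Topology ComplexConjugate ComplexInnerProductSpace
open Bundle Module Literature.Geometry.Kaehler

namespace Literature.NumberTheory.Transcendental

-- The identification `TangentSpace I x = E` is an abuse of definitional equality (see
-- `NormedSpace.fromTangentSpace`); as in Mathlib's tangent-bundle files we let `isDefEq` unfold it.
set_option backward.isDefEq.respectTransparency false

variable {E : Type*} [NormedAddCommGroup E] [NormedSpace ℂ E] [FiniteDimensional ℂ E]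
  {n : ℕ} [Fact (finrank ℝ E = n)]
  {M : Type*} [TopologicalSpace M] [ChartedSpace E M]
  [IsManifold 𝓘(ℂ, E) ω M] [IsManifold 𝓘(ℝ, E) ∞ M]

/-! ### `dim_ℂ ℋ^{p,q} = h^{p,q}` from the Hodge theorem for `∂̄` -/

section HodgeTheorem

variable (g : ContMDiffRiemannianMetric 𝓘(ℝ, E) ∞ E (fun x : M ↦ TangentSpace 𝓘(ℝ, E) x))
  (o : (x : M) → Orientation ℝ (TangentSpace 𝓘(ℝ, E) x) (Fin n)) {m : ℕ}

/-- **`dim_ℂ ℋ^{p,q} = h^{p,q}` from the Hodge theorem for `∂̄`.** On a compact complex manifold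
`M` with a smooth metric `g` and orientation family `o`, the named fact
`existsUnique_isDolbeaultHarmonic_mk_eq g o` (every Dolbeault class `c ∈ H^{p,q}_{∂̄}(M)` has a
unique `Δ_∂̄`-harmonic representative, for `g` Hermitian and `vol_o` smooth; Voisin (2002),
Thm. 5.24) implies the named fact `finrank_dolbeaultHarmonicForms_eq_hodgeNumber g o`
(`dim_ℂ ℋ^{p,q} = h^{p,q} = dim_ℂ H^{p,q}_{∂̄}`): the class map `ℋ^{p,q} →ₗ[ℂ] H^{p,q}_{∂̄}`,
`α ↦ [α]` — well defined because `ℋ^{p,q} ≤ Z^{p,q}_{∂̄}`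
(`dolbeaultHarmonicForms_le_dolbeaultClosedForms_of_isManifold_complex`; Voisin, Cor. 5.13) — is
surjective by the existence half and injective by the uniqueness half (two elements of `ℋ^{p,q}`
are `∂̄`-harmonic `(p,q)`-forms, `mem_dolbeaultHarmonicForms_iff_of_contMDiffMetric`, representing
the same class), so it is a linear equivalence and `finrank` agrees (`LinearEquiv.finrank_eq`).
Voisin (2002), §5.3.1, Thm. 5.24 and the proof of Lemma 6.18; Huybrechts (2005), Cor. 3.2.9
(`H^{p,q}(X) ≅ ℋ^{p,q}_{∂̄}(X, g)`). [cite: Voisin2002, Thm. 5.24] -/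
theorem finrank_dolbeaultHarmonicForms_eq_hodgeNumber_of_existsUnique
    (hH : existsUnique_isDolbeaultHarmonic_mk_eq (m := m) g o) :
    finrank_dolbeaultHarmonicForms_eq_hodgeNumber (m := m) g o := by
  intro _ _ hg p q h
  letI : RiemannianBundle (fun x : M ↦ TangentSpace 𝓘(ℝ, E) x) := ⟨g.toRiemannianMetric⟩
  haveI : IsContMDiffRiemannianBundle 𝓘(ℝ, E) ∞ E (fun x : M ↦ TangentSpace 𝓘(ℝ, E) x) :=
    ⟨g.inner, g.contMDiff, fun _ _ _ ↦ rfl⟩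
  intro ho
  have hZ : dolbeaultHarmonicForms o p q h ≤ dolbeaultClosedForms E M p q :=
    dolbeaultHarmonicForms_le_dolbeaultClosedForms_of_isManifold_complex g o hg h ho
  have hU := hH hg h ho
  -- elements of the span `ℋ^{p,q}` are `∂̄`-harmonic `(p,q)`-forms
  have hmem : ∀ a : ↥(dolbeaultHarmonicForms o p q h),
      IsDolbeaultHarmonic o p q h (a : MForm 𝓘(ℝ, E) M ℂ (p + q)) := fun a ↦
    (mem_dolbeaultHarmonicForms_iff_of_contMDiffMetric o ho rfl h _).1 a.2
  -- the class map `ℋ^{p,q} → H^{p,q}`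
  let φ : ↥(dolbeaultHarmonicForms o p q h) →ₗ[ℂ] dolbeaultCohomology E M p q :=
    (dolbeaultCohomology.mk E M p q).comp (Submodule.inclusion hZ)
  have hφ : ∀ a, φ a = dolbeaultCohomology.mk E M p q (Submodule.inclusion hZ a) := fun _ ↦ rfl
  have hinj : Function.Injective φ := by
    intro a b hab
    obtain ⟨γ, -, huniq⟩ := hU (φ a)
    have ea : Submodule.inclusion hZ a = γ := huniq _ ⟨hmem a, (hφ a).symm⟩
    have eb : Submodule.inclusion hZ b = γ := huniq _ ⟨hmem b, by rw [← hφ b, hab]⟩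
    exact Submodule.inclusion_injective hZ (ea.trans eb.symm)
  have hsurj : Function.Surjective φ := by
    intro c
    obtain ⟨γ, ⟨hγ, hγc⟩, -⟩ := hU c
    exact ⟨⟨(γ : MForm 𝓘(ℝ, E) M ℂ (p + q)), hγ.mem_dolbeaultHarmonicForms⟩, hγc⟩
  rw [hodgeNumber]
  exact (LinearEquiv.ofBijective φ ⟨hinj, hsurj⟩).finrank_eq

end HodgeTheorem

/-! ### Hodge symmetry from the Hodge theorem for `∂̄` and the Kähler identity -/

section Assembly

/-- **Hodge symmetry from the Hodge theorem for `∂̄` and the Kähler identity `Δ_∂̄ = Δ_∂`.** On a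
compact complex manifold admitting a smooth Kähler metric, `h^{p,q} = h^{q,p}` — the named fact
`hodgeNumber_symm_of_isKaehlerManifold` — follows from: `hH`, the Hodge theorem for `∂̄` for every
smooth metric and orientation family (named fact `existsUnique_isDolbeaultHarmonic_mk_eq g o`;
Voisin (2002), Thm. 5.24), and `hK`, the Kähler identity `Δ_∂̄ = Δ_∂` on smooth forms for every
smooth Kähler metric (corrected named fact `dolbeaultLaplacian_eq_delLaplacian_of_isManifold_complex
g o`; Voisin (2002), Thm. 6.7). Proof as printed (Voisin, Cor. 6.12 with Lemma 6.18; Huybrechts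
(2005), Cor. 3.2.12 via Remarks 3.2.7 (i)): `hK` gives `\overline{ℋ^{p,q}} = ℋ^{q,p}`
(`dolbeaultHarmonicForms_conj_of_isManifold_complex_of_dolbeaultLaplacian_eq_delLaplacian`), `hH`
gives `dim ℋ^{p,q} = h^{p,q}` (`finrank_dolbeaultHarmonicForms_eq_hodgeNumber_of_existsUnique`), and
`hodgeNumber_symm_of_isKaehlerManifold_of_dolbeaultHarmonicForms_conj` does the bookkeeping.
[cite: Voisin2002, Cor. 6.12] -/
theorem hodgeNumber_symm_of_isKaehlerManifold_of_existsUnique_of_kaehlerIdentity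
    (hH : ∀ (g : ContMDiffRiemannianMetric 𝓘(ℝ, E) ∞ E (fun x : M ↦ TangentSpace 𝓘(ℝ, E) x))
      (o : (x : M) → Orientation ℝ (TangentSpace 𝓘(ℝ, E) x) (Fin n)) {m : ℕ},
      existsUnique_isDolbeaultHarmonic_mk_eq (m := m) g o)
    (hK : ∀ (g : ContMDiffRiemannianMetric 𝓘(ℝ, E) ∞ E (fun x : M ↦ TangentSpace 𝓘(ℝ, E) x))
      (o : (x : M) → Orientation ℝ (TangentSpace 𝓘(ℝ, E) x) (Fin n)) {k m : ℕ},
      dolbeaultLaplacian_eq_delLaplacian_of_isManifold_complex (k := k) (m := m) g o) :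
    hodgeNumber_symm_of_isKaehlerManifold (E := E) (M := M) :=
  hodgeNumber_symm_of_isKaehlerManifold_of_dolbeaultHarmonicForms_conj (n := n)
    (fun g o ↦ finrank_dolbeaultHarmonicForms_eq_hodgeNumber_of_existsUnique g o (hH g o))
    (fun g o ↦ (dolbeaultHarmonicForms_conj_of_isManifold_complex_iff g o).1
      (dolbeaultHarmonicForms_conj_of_isManifold_complex_of_dolbeaultLaplacian_eq_delLaplacian g o
        (hK g o)))

/-- **Hodge symmetry from Warner's Theorems 6.5 and 6.6 for `Δ_∂̄` and the Kähler identity.** As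
`hodgeNumber_symm_of_isKaehlerManifold_of_existsUnique_of_kaehlerIdentity`, with the Hodge theorem
for `∂̄` replaced by its analytic inputs on the Hermitian inner product spaces `A^{p,q}(M)`
(`CL2SmoothForms.pq o p q`, operator `Δ_∂̄ = CL2SmoothForms.pqLaplacian o hJ p q h`), assumed for
every smooth metric `g` (Hermitian in the instance form `hJ`) and every orientation family `o`
with smooth volume form: `hC` — every sequence `(uᵢ)` with `‖uᵢ‖`, `‖Δ_∂̄ uᵢ‖` bounded has a Cauchy
subsequence (Warner (1983), Thm. 6.6; Voisin (2002), Thm. 5.22) — and `hR` — every weak solution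
`ℓ` of `Δ_∂̄ w = α` is represented by a smooth form (Warner (1983), Thm. 6.5). Through
`existsUnique_isDolbeaultHarmonic_mk_eq_of_regularity_of_compactness`
(`KaehlerHodgeEllipticRepresentativeProofs.lean`). This is the term that discharges
`hodgeNumber_symm_of_isKaehlerManifold` once the elliptic theory of `Δ_∂̄` and the Kähler
identities are in the tree. [cite: Voisin2002, Cor. 6.12; Thm. 5.22, Thm. 5.24, Thm. 6.7] -/
theorem hodgeNumber_symm_of_isKaehlerManifold_of_regularity_of_compactness_of_kaehlerIdentity
    (hC : ∀ (g : ContMDiffRiemannianMetric 𝓘(ℝ, E) ∞ E (fun x : M ↦ TangentSpace 𝓘(ℝ, E) x))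
      (o : (x : M) → Orientation ℝ (TangentSpace 𝓘(ℝ, E) x) (Fin n)) {m : ℕ}
      [MeasurableSpace E] [BorelSpace E] [CompactSpace M] [T2Space M]
      (hJ : letI : RiemannianBundle (fun x : M ↦ TangentSpace 𝓘(ℝ, E) x) := ⟨g.toRiemannianMetric⟩
        ∀ (x : M) (v w : TangentSpace 𝓘(ℝ, E) x),
          inner ℝ (tangentJ E x v) (tangentJ E x w) = inner ℝ v w)
      (p q : ℕ) (h : (p + q) + m = n)
      (ho : letI : RiemannianBundle (fun x : M ↦ TangentSpace 𝓘(ℝ, E) x) := ⟨g.toRiemannianMetric⟩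
        IsSmoothForm (riemannianVolumeForm o)),
      letI : RiemannianBundle (fun x : M ↦ TangentSpace 𝓘(ℝ, E) x) := ⟨g.toRiemannianMetric⟩
      haveI : IsContMDiffRiemannianBundle 𝓘(ℝ, E) ∞ E (fun x : M ↦ TangentSpace 𝓘(ℝ, E) x) :=
        ⟨g.inner, g.contMDiff, fun _ _ _ ↦ rfl⟩
      haveI : Fact (IsSmoothForm (riemannianVolumeForm o)) := ⟨ho⟩
      ∀ (u : ℕ → CL2SmoothForms.pq o p q) (c : ℝ), (∀ i, ‖u i‖ ≤ c) →
        (∀ i, ‖CL2SmoothForms.pqLaplacian o hJ p q h (u i)‖ ≤ c) →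
          ∃ φ : ℕ → ℕ, StrictMono φ ∧ CauchySeq (u ∘ φ))
    (hR : ∀ (g : ContMDiffRiemannianMetric 𝓘(ℝ, E) ∞ E (fun x : M ↦ TangentSpace 𝓘(ℝ, E) x))
      (o : (x : M) → Orientation ℝ (TangentSpace 𝓘(ℝ, E) x) (Fin n)) {m : ℕ}
      [MeasurableSpace E] [BorelSpace E] [CompactSpace M] [T2Space M]
      (hJ : letI : RiemannianBundle (fun x : M ↦ TangentSpace 𝓘(ℝ, E) x) := ⟨g.toRiemannianMetric⟩
        ∀ (x : M) (v w : TangentSpace 𝓘(ℝ, E) x),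
          inner ℝ (tangentJ E x v) (tangentJ E x w) = inner ℝ v w)
      (p q : ℕ) (h : (p + q) + m = n)
      (ho : letI : RiemannianBundle (fun x : M ↦ TangentSpace 𝓘(ℝ, E) x) := ⟨g.toRiemannianMetric⟩
        IsSmoothForm (riemannianVolumeForm o)),
      letI : RiemannianBundle (fun x : M ↦ TangentSpace 𝓘(ℝ, E) x) := ⟨g.toRiemannianMetric⟩
      haveI : IsContMDiffRiemannianBundle 𝓘(ℝ, E) ∞ E (fun x : M ↦ TangentSpace 𝓘(ℝ, E) x) :=
        ⟨g.inner, g.contMDiff, fun _ _ _ ↦ rfl⟩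
      haveI : Fact (IsSmoothForm (riemannianVolumeForm o)) := ⟨ho⟩
      ∀ (α : CL2SmoothForms.pq o p q) (ℓ : CL2SmoothForms.pq o p q →L[ℂ] ℂ),
        (∀ φ, ℓ (CL2SmoothForms.pqLaplacian o hJ p q h φ) = ⟪α, φ⟫) →
          ∃ w : CL2SmoothForms.pq o p q, ∀ φ, ℓ φ = ⟪w, φ⟫)
    (hK : ∀ (g : ContMDiffRiemannianMetric 𝓘(ℝ, E) ∞ E (fun x : M ↦ TangentSpace 𝓘(ℝ, E) x))
      (o : (x : M) → Orientation ℝ (TangentSpace 𝓘(ℝ, E) x) (Fin n)) {k m : ℕ},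
      dolbeaultLaplacian_eq_delLaplacian_of_isManifold_complex (k := k) (m := m) g o) :
    hodgeNumber_symm_of_isKaehlerManifold (E := E) (M := M) :=
  hodgeNumber_symm_of_isKaehlerManifold_of_existsUnique_of_kaehlerIdentity
    (fun g o _ ↦ existsUnique_isDolbeaultHarmonic_mk_eq_of_regularity_of_compactness g o
      (fun hJ p q h ho ↦ hC g o hJ p q h ho) (fun hJ p q h ho ↦ hR g o hJ p q h ho))
    hK

end Assembly

end Literature.NumberTheory.Transcendental
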